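import Summits.AtomisticToContinuum.Crystallization.Theorems.FarFieldGapR.Negative.RayWitness

/-!
# `NearFarGlueR` (stmt-AtomisticToContinuum-14970), negative side IV: the POINTWISE contact gap is false

The picked line reduces the crux to the GLOBAL contact gap `ContactGapAt 3` (bad particles within `3`
of a good particle pay `g₂` each in the total energy).  Its pointwise strengthening — "a contact-bad
particle has site energy `≥ e* + g`" — is FALSE for every admissible dependence on `δ`
(`not_pointwiseContactGap`): next to the centre of an exact fcc two-shell environment sits, at
distance `3`, a bad particle crowded by `M` collinear particles at distances in `[1, 7/5]`
(pairwise `2/(5M)`-separated); `V_LJ ≤ V_LJ(7/5) ≤ −1/50` there and `V_LJ ≤ 0` beyond `1`, so its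
site energy is `≤ −M/100 < e*` once `M > −100·e*`, while the crowd's own repulsion is invisible to a
site-wise inequality.  Lesson: keep `ContactGap` global (or boundary-charged).  All `[folklore]`.
-/

noncomputable section

namespace Summit.AtomisticToContinuum.Crystallization.Theorems.NearFarGlueRNegative

open scoped BigOperators
open Literature.MathematicalPhysics.StatisticalMechanics Literature.Geometry.DiscreteGeometry
open Summit.AtomisticToContinuum.Crystallization.Theorems.FarFieldGapRNegative
  (one_div_twenty_le not_isTwoShellGood_of_crowded)

/-! ### Lennard-Jones facts -/

/-- `V_LJ` is increasing on `[1, ∞)`: for `1 ≤ s ≤ t`, `V_LJ(s) ≤ V_LJ(t)`. [folklore] -/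
theorem lennardJones_mono_of_one_le {s t : ℝ} (hs : 1 ≤ s) (hst : s ≤ t) :
    lennardJones s ≤ lennardJones t := by
  unfold lennardJones
  have hs0 : 0 < s := by linarith
  have ht0 : 0 < t := by linarith
  set u : ℝ := (s⁻¹) ^ 6 with hu
  set v : ℝ := (t⁻¹) ^ 6 with hv
  have hu1 : u ≤ 1 := by
    rw [hu]; exact pow_le_one₀ (inv_nonneg.2 hs0.le) (inv_le_one_of_one_le₀ hs)
  have hv0 : 0 ≤ v := by positivity
  have hvu : v ≤ u := pow_le_pow_left₀ (inv_nonneg.2 ht0.le) (inv_anti₀ hs0 hst) 6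
  have h12s : (s⁻¹) ^ 12 = u ^ 2 := by rw [hu, ← pow_mul]
  have h12t : (t⁻¹) ^ 12 = v ^ 2 := by rw [hv, ← pow_mul]
  rw [h12s, h12t]
  nlinarith [mul_nonneg (sub_nonneg.2 hvu) (by linarith : (0 : ℝ) ≤ 2 - u - v)]

/-- `V_LJ(7/5) ≤ −1/50`. [folklore] -/
theorem lennardJones_seven_fifths_le : lennardJones (7 / 5) ≤ -1 / 50 := by norm_num [lennardJones]

/-- On `[1, 7/5]` the potential is `≤ −1/50`. [folklore] -/
theorem lennardJones_le_of_mem {d : ℝ} (h1 : 1 ≤ d) (h2 : d ≤ 7 / 5) : lennardJones d ≤ -1 / 50 :=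
  (lennardJones_mono_of_one_le h1 h2).trans lennardJones_seven_fifths_le

/-! ### The witness configuration -/

/-- Positions on the axis: the good centre `0`, the crowded particle `3`, the crowd `4 + 2n/(5M)`. [folklore] -/
def rho (M : ℕ) : ℕ → ℝ
  | 0 => 0
  | 1 => 3
  | n + 2 => 4 + 2 / 5 * (n : ℝ) / M

/-- The axis points as vectors of `ℝ³`. [folklore] -/
def linePt (M : ℕ) (k : Fin (M + 2)) : EuclideanSpace ℝ (Fin 3) :=
  EuclideanSpace.single 0 (rho M k.val)

/-- An enumeration of the eighteen fcc two-shell points. [folklore] -/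
def eP : {v // v ∈ fccTwoShellPattern} ≃ Fin 18 :=
  Fintype.equivFinOfCardEq (by rw [Fintype.card_coe, card_fccTwoShellPattern])

/-- The pattern points, indexed by `Fin 18`. [folklore] -/
def patPt (k : Fin 18) : EuclideanSpace ℝ (Fin 3) := (eP.symm k).1

/-- **The witness**: the exact fcc two-shell environment of the origin, then the axis points. [folklore] -/
def cfg (M : ℕ) : Fin (18 + (M + 2)) → EuclideanSpace ℝ (Fin 3) :=
  Fin.append patPt (linePt M)

/-- The indexed pattern points lie in the pattern. [folklore] -/
theorem patPt_mem (k : Fin 18) : patPt k ∈ fccTwoShellPattern := (eP.symm k).2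

/-- Pattern points have norm `≥ 1`. [folklore] -/
theorem one_le_norm_patPt (k : Fin 18) : 1 ≤ ‖patPt k‖ := by
  rcases norm_of_mem_fccTwoShellPattern (patPt_mem k) with h | h <;> rw [h]
  exact Real.one_le_sqrt.2 (by norm_num)

/-- Pattern points have norm `≤ √2`. [folklore] -/
theorem norm_patPt_le (k : Fin 18) : ‖patPt k‖ ≤ Real.sqrt 2 :=
  norm_le_sqrt_two_of_mem_twoShellPattern (Or.inl rfl) (patPt_mem k)

/-- `√2 < 1.42`. [folklore] -/
theorem sqrt_two_lt : Real.sqrt 2 < 1.42 := by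
  have h := Real.sq_sqrt (show (0:ℝ) ≤ 2 by norm_num)
  nlinarith [Real.sqrt_nonneg 2]

/-- `‖t e₀‖ = t` for `t ≥ 0`. [folklore] -/
theorem norm_single_zero {t : ℝ} (ht : 0 ≤ t) : ‖EuclideanSpace.single (0 : Fin 3) t‖ = t := by
  rw [EuclideanSpace.norm_eq]
  simp [Real.sqrt_sq ht]

/-- The indexing of the pattern is injective. [folklore] -/
theorem patPt_injective : Function.Injective patPt := fun _ _ hkl =>
  eP.symm.injective (Subtype.ext hkl)

/-- Distances between axis points. [folklore] -/
theorem dist_linePt (M : ℕ) (k l : Fin (M + 2)) :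
    dist (linePt M k) (linePt M l) = |rho M k.val - rho M l.val| := by
  rw [linePt, linePt, EuclideanSpace.dist_eq]
  simp [Fin.sum_univ_three]
  exact Real.dist_eq _ _

/-- A pattern point is at distance `≥ 1` from the origin axis point and `≥ 3 − √2` from the others. [folklore] -/
theorem dist_patPt_linePt_ge (M : ℕ) (k : Fin 18) (l : Fin (M + 2)) (hM : 0 < M) :
    1 ≤ dist (patPt k) (linePt M l) := by
  rw [linePt]
  rcases l with ⟨_ | _ | n, hl⟩
  · -- the origin
    simp only [rho]
    rw [show EuclideanSpace.single (0 : Fin 3) (0 : ℝ) = 0 by simp, dist_zero_right]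
    exact one_le_norm_patPt k
  · -- the particle at `3`
    simp only [rho]
    have h := norm_sub_norm_le (EuclideanSpace.single (0 : Fin 3) (3 : ℝ)) (patPt k)
    rw [norm_single_zero (by norm_num : (0:ℝ) ≤ 3), ← dist_eq_norm, dist_comm] at h
    linarith [norm_patPt_le k, sqrt_two_lt]
  · -- a crowd particle at `4 + 2n/(5M) ≥ 4`
    simp only [rho]
    have hpos : (0 : ℝ) ≤ 4 + 2 / 5 * (n : ℝ) / M := by positivity
    have h := norm_sub_norm_le (EuclideanSpace.single (0 : Fin 3) (4 + 2 / 5 * (n : ℝ) / M)) (patPt k)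
    rw [norm_single_zero hpos, ← dist_eq_norm, dist_comm] at h
    have h4 : (4 : ℝ) ≤ 4 + 2 / 5 * (n : ℝ) / M := by linarith [show (0:ℝ) ≤ 2 / 5 * (n : ℝ) / M by positivity]
    linarith [norm_patPt_le k, sqrt_two_lt]

/-- Values of `rho` on the crowd are in `[4, 22/5]`. [folklore] -/
theorem rho_crowd_mem {M n : ℕ} (hn : n < M) :
    (4 : ℝ) ≤ rho M (n + 2) ∧ rho M (n + 2) ≤ 4 + 2 / 5 := by
  have hM : (0 : ℝ) < M := by exact_mod_cast (Nat.zero_le n).trans_lt hn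
  have hnM : (n : ℝ) ≤ M := by exact_mod_cast hn.le
  simp only [rho]
  have h1 : (0 : ℝ) ≤ 2 / 5 * (n : ℝ) / M := by positivity
  have h2 : 2 / 5 * (n : ℝ) / M ≤ 2 / 5 := by rw [div_le_iff₀ hM]; nlinarith
  constructor <;> linarith

/-- Distinct crowd points are `2/(5M)`-separated. [folklore] -/
theorem rho_crowd_sep {M n m : ℕ} (hM : 0 < M) (hnm : n ≠ m) :
    2 / (5 * (M : ℝ)) ≤ |rho M (n + 2) - rho M (m + 2)| := by
  have hMr : (0 : ℝ) < M := by exact_mod_cast hM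
  simp only [rho]
  have hdiff : (1 : ℝ) ≤ |(n : ℝ) - (m : ℝ)| := by
    rcases Nat.lt_or_gt_of_ne hnm with h | h
    · have : (n : ℝ) + 1 ≤ m := by exact_mod_cast h
      rw [abs_sub_comm, abs_of_nonneg (by linarith)]; linarith
    · have : (m : ℝ) + 1 ≤ n := by exact_mod_cast h
      rw [abs_of_nonneg (by linarith)]; linarith
  have key : (4 + 2 / 5 * (n : ℝ) / M) - (4 + 2 / 5 * (m : ℝ) / M) = (2 / (5 * M)) * ((n : ℝ) - m) := by
    field_simp; ring
  rw [key, abs_mul, abs_of_pos (by positivity : (0 : ℝ) < 2 / (5 * M))]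
  have h25 : (0 : ℝ) < 2 / (5 * M) := by positivity
  nlinarith

/-- **The witness is `2/(5M)`-separated** (`M ≥ 1`). [folklore] -/
theorem cfg_separated {M : ℕ} (hM : 0 < M) :
    ∀ a b : Fin (18 + (M + 2)), a ≠ b → 2 / (5 * (M : ℝ)) ≤ dist (cfg M a) (cfg M b) := by
  have hMr : (1 : ℝ) ≤ M := by exact_mod_cast hM
  have hδ1 : 2 / (5 * (M : ℝ)) ≤ 1 := by
    rw [div_le_iff₀ (by positivity)]; linarith
  intro a b hab
  induction a using Fin.addCases with
  | left k =>
    induction b using Fin.addCases with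
    | left l =>
      simp only [cfg, Fin.append_left]
      have hkl : k ≠ l := fun h => hab (by rw [h])
      exact hδ1.trans (one_le_dist_of_mem_fccTwoShellPattern (patPt_mem k) (patPt_mem l)
        (fun h => hkl (patPt_injective h)))
    | right l =>
      simp only [cfg, Fin.append_left, Fin.append_right]
      exact hδ1.trans (dist_patPt_linePt_ge M k l hM)
  | right k =>
    induction b using Fin.addCases with
    | left l =>
      simp only [cfg, Fin.append_left, Fin.append_right]
      rw [dist_comm]
      exact hδ1.trans (dist_patPt_linePt_ge M l k hM)
    | right l =>
      simp only [cfg, Fin.append_right]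
      rw [dist_linePt]
      have hkl : k.val ≠ l.val := fun h => hab (by rw [Fin.ext h])
      rcases k with ⟨_ | _ | n, hk⟩ <;> rcases l with ⟨_ | _ | m, hl⟩ <;>
        simp only at hkl ⊢
      · exact absurd rfl hkl
      · simp only [rho]; rw [abs_of_nonpos (by norm_num)]; linarith
      · have := (rho_crowd_mem (M := M) (n := m) (by omega)).1
        simp only [rho] at this ⊢; rw [abs_of_nonpos (by linarith)]; linarith
      · simp only [rho]; rw [abs_of_nonneg (by norm_num)]; linarith
      · exact absurd rfl hkl
      · have := (rho_crowd_mem (M := M) (n := m) (by omega)).1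
        simp only [rho] at this ⊢; rw [abs_of_nonpos (by linarith)]; linarith
      · have := (rho_crowd_mem (M := M) (n := n) (by omega)).1
        simp only [rho] at this ⊢; rw [abs_of_nonneg (by linarith)]; linarith
      · have := (rho_crowd_mem (M := M) (n := n) (by omega)).1
        simp only [rho] at this ⊢; rw [abs_of_nonneg (by linarith)]; linarith
      · exact rho_crowd_sep hM (by omega)

/-! ### Named indices -/

/-- Index of the good centre (the origin). [folklore] -/
def iO (M : ℕ) : Fin (18 + (M + 2)) := Fin.natAdd 18 ⟨0, by omega⟩
/-- Index of the crowded particle at `3`. [folklore] -/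
def iQ (M : ℕ) : Fin (18 + (M + 2)) := Fin.natAdd 18 ⟨1, by omega⟩
/-- Index of the `n`-th crowd particle. [folklore] -/
def iC (M : ℕ) (n : Fin M) : Fin (18 + (M + 2)) := Fin.natAdd 18 ⟨n.val + 2, by omega⟩

/-- The right block of the witness is the axis. [folklore] -/
theorem cfg_natAdd (M : ℕ) (l : Fin (M + 2)) : cfg M (Fin.natAdd 18 l) = linePt M l := by rw [cfg, Fin.append_right]

/-- The left block of the witness is the pattern. [folklore] -/
theorem cfg_castAdd (M : ℕ) (k : Fin 18) : cfg M (Fin.castAdd (M + 2) k) = patPt k := by rw [cfg, Fin.append_left]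

/-- Position of the good centre. [folklore] -/
theorem cfg_iO (M : ℕ) : cfg M (iO M) = linePt M ⟨0, by omega⟩ := cfg_natAdd M _
/-- Position of the crowded particle. [folklore] -/
theorem cfg_iQ (M : ℕ) : cfg M (iQ M) = linePt M ⟨1, by omega⟩ := cfg_natAdd M _
/-- Position of a crowd particle. [folklore] -/
theorem cfg_iC (M : ℕ) (n : Fin M) : cfg M (iC M n) = linePt M ⟨n.val + 2, by omega⟩ := cfg_natAdd M _

/-- The first axis point is the origin. [folklore] -/
theorem linePt_zero (M : ℕ) : linePt M ⟨0, by omega⟩ = 0 := by simp [linePt, rho]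

/-- Crowd indices are distinct. [folklore] -/
theorem iC_injective (M : ℕ) : Function.Injective (iC M) := fun n m h => by
  have := congrArg Fin.val h; simp [iC] at this; exact Fin.ext this

/-- A crowd index is not the crowded particle. [folklore] -/
theorem iC_ne_iQ (M : ℕ) (n : Fin M) : iC M n ≠ iQ M := fun h => by
  have := congrArg Fin.val h; simp [iC, iQ] at this; omega

/-- A pattern index is not the centre. [folklore] -/
theorem castAdd_ne_iO (M : ℕ) (k : Fin 18) : Fin.castAdd (M + 2) k ≠ iO M := fun h => by
  have := congrArg Fin.val h; simp [iO] at this; omega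

/-- Distance from the crowded particle to a crowd particle is in `[1, 7/5]`. [folklore] -/
theorem dist_iQ_iC {M : ℕ} (n : Fin M) :
    1 ≤ dist (cfg M (iQ M)) (cfg M (iC M n)) ∧ dist (cfg M (iQ M)) (cfg M (iC M n)) ≤ 7 / 5 := by
  have hb := rho_crowd_mem (M := M) n.2
  rw [cfg_iQ, cfg_iC, dist_linePt]
  simp only [rho] at hb ⊢
  rw [abs_of_nonpos (by linarith)]
  constructor <;> linarith

/-- The crowded particle is at distance `3` from the good centre. [folklore] -/
theorem dist_iO_iQ (M : ℕ) : dist (cfg M (iO M)) (cfg M (iQ M)) = 3 := by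
  rw [cfg_iO, cfg_iQ, dist_linePt]; simp only [rho]; norm_num

/-- Every other particle is at distance `≥ 1` from the crowded particle. [folklore] -/
theorem one_le_dist_iQ {M : ℕ} (hM : 0 < M) (j : Fin (18 + (M + 2))) (hj : j ≠ iQ M) :
    1 ≤ dist (cfg M (iQ M)) (cfg M j) := by
  induction j using Fin.addCases with
  | left k =>
    rw [dist_comm, cfg_castAdd, cfg_iQ]
    exact dist_patPt_linePt_ge M k ⟨1, by omega⟩ hM
  | right l =>
    rw [cfg_iQ, cfg_natAdd, dist_linePt]
    rcases l with ⟨_ | _ | n, hl⟩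
    · simp only [rho]; norm_num
    · exact absurd rfl hj
    · have := (rho_crowd_mem (M := M) (n := n) (by omega)).1
      simp only [rho] at this ⊢
      rw [abs_of_nonpos (by linarith)]; linarith

/-! ### Goodness of the centre, badness of the crowded particle -/

/-- The assignment of pattern vectors to particles witnessing the goodness of the centre. [folklore] -/
def assign (M : ℕ) (v : EuclideanSpace ℝ (Fin 3)) : Fin (18 + (M + 2)) :=
  if h : v ∈ fccTwoShellPattern then Fin.castAdd (M + 2) (eP ⟨v, h⟩) else iO M

/-- The assignment on pattern vectors. [folklore] -/
theorem assign_of_mem (M : ℕ) {v : EuclideanSpace ℝ (Fin 3)} (hv : v ∈ fccTwoShellPattern) :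
    assign M v = Fin.castAdd (M + 2) (eP ⟨v, hv⟩) := by rw [assign, dif_pos hv]

/-- `patPt ∘ eP = id` on the pattern. [folklore] -/
theorem patPt_eP {v : EuclideanSpace ℝ (Fin 3)} (hv : v ∈ fccTwoShellPattern) :
    patPt (eP ⟨v, hv⟩) = v := by simp [patPt]

/-- `eP ∘ patPt = id`. [folklore] -/
theorem eP_patPt (k : Fin 18) : eP ⟨patPt k, patPt_mem k⟩ = k := by
  have : (⟨patPt k, patPt_mem k⟩ : {v // v ∈ fccTwoShellPattern}) = eP.symm k := Subtype.ext rfl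
  rw [this, Equiv.apply_symm_apply]

/-- **The origin is `1/20`-good** (indeed exactly good: its `3/2`-neighbourhood is the fcc two-shell pattern). [folklore] -/
theorem good_iO (M : ℕ) : IsTwoShellGood (1 / 20) (47 / 50) 1 (cfg M) (iO M) := by
  refine ⟨1, by norm_num, le_rfl, LinearIsometry.id, fccTwoShellPattern, assign M,
    Or.inl rfl, fun v hv => ⟨?_, ?_⟩, ?_, fun j hj hd => ?_⟩
  · rw [assign_of_mem M hv]
    exact castAdd_ne_iO M _
  · rw [assign_of_mem M hv, cfg_castAdd, cfg_iO, linePt_zero, patPt_eP hv]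
    simp
  · intro v hv w hw hvw
    have hv' : v ∈ fccTwoShellPattern := hv
    have hw' : w ∈ fccTwoShellPattern := hw
    rw [assign_of_mem M hv', assign_of_mem M hw'] at hvw
    have h1 : (eP ⟨v, hv'⟩).val = (eP ⟨w, hw'⟩).val := by
      have := congrArg Fin.val hvw
      simpa using this
    exact congrArg Subtype.val (eP.injective (Fin.ext h1))
  · induction j using Fin.addCases with
    | left k =>
      refine ⟨patPt k, patPt_mem k, ?_⟩
      rw [assign_of_mem M (patPt_mem k), eP_patPt]
    | right l =>
      exfalso
      rw [cfg_natAdd, cfg_iO, dist_linePt] at hd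
      rcases l with ⟨_ | _ | n, hl⟩
      · exact hj rfl
      · simp only [rho] at hd; norm_num at hd
      · have := (rho_crowd_mem (M := M) (n := n) (by omega)).1
        simp only [rho] at hd this
        rw [sub_zero, abs_of_nonneg (by linarith)] at hd
        linarith

/-- **The crowded particle is bad** as soon as `M ≥ 19`: it has more than `18` particles within
`141/100 ≤ 3a/2` (the sibling disprover's `not_isTwoShellGood_of_crowded`). [folklore] -/
theorem not_good_iQ {M : ℕ} (hM : 19 ≤ M) : ¬ IsTwoShellGood (1 / 20) (47 / 50) 1 (cfg M) (iQ M) := by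
  classical
  refine not_isTwoShellGood_of_crowded ((Finset.univ : Finset (Fin M)).image (iC M)) ?_ ?_
  · rw [Finset.card_image_of_injective _ (iC_injective M), Finset.card_univ, Fintype.card_fin]
    exact hM
  · intro j hj
    obtain ⟨n, -, rfl⟩ := Finset.mem_image.1 hj
    refine ⟨iC_ne_iQ M n, ?_⟩
    rw [dist_comm]
    linarith [(dist_iQ_iC (M := M) n).2]

/-! ### The site energy of the crowded particle -/

/-- **The crowd pushes the site energy of the crowded particle below `−M/100`.** [folklore] -/
theorem halfSite_iQ_le {M : ℕ} (hM : 0 < M) :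
    (1 / 2 : ℝ) * ∑ j ∈ Finset.univ.erase (iQ M), lennardJones (dist (cfg M (iQ M)) (cfg M j)) ≤
      -(M : ℝ) / 100 := by
  classical
  set S := (Finset.univ : Finset (Fin M)).image (iC M) with hS
  have hScard : S.card = M := by
    rw [hS, Finset.card_image_of_injective _ (iC_injective M), Finset.card_univ, Fintype.card_fin]
  have hSsub : S ⊆ Finset.univ.erase (iQ M) := by
    intro j hj
    obtain ⟨n, -, rfl⟩ := Finset.mem_image.1 hj
    exact Finset.mem_erase.2 ⟨iC_ne_iQ M n, Finset.mem_univ _⟩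
  have hpt : ∀ j ∈ Finset.univ.erase (iQ M),
      lennardJones (dist (cfg M (iQ M)) (cfg M j)) ≤ if j ∈ S then -1 / 50 else 0 := by
    intro j hj
    have hjq : j ≠ iQ M := (Finset.mem_erase.1 hj).1
    split_ifs with hjS
    · obtain ⟨n, -, rfl⟩ := Finset.mem_image.1 hjS
      exact lennardJones_le_of_mem (dist_iQ_iC n).1 (dist_iQ_iC n).2
    · exact lennardJones_nonpos (one_le_dist_iQ hM j hjq)
  have hsum := Finset.sum_le_sum hpt
  rw [Finset.sum_ite_mem, Finset.inter_eq_right.2 hSsub, Finset.sum_const, hScard,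
    nsmul_eq_mul] at hsum
  linarith

/-! ### The refutation -/

/-- **The pointwise contact gap is FALSE.**  No `g > 0` makes "a bad particle within `3` of a
good particle has site energy `≥ e* + g`" true on `δ`-separated configurations, whatever `δ > 0`
is allowed to be: the witness `cfg M` (`M = max 19 (⌈−100 e*⌉ + 1)`, `δ = 2/(5M)`) has a good
centre, a bad particle at distance `3` from it, and that particle's site energy is `< e*`.
[folklore] -/
theorem not_pointwiseContactGap :
    ¬ (∀ δ : ℝ, 0 < δ → ∃ g : ℝ, 0 < g ∧ ∀ (N : ℕ) (x : Fin N → EuclideanSpace ℝ (Fin 3)),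
        (∀ i j : Fin N, i ≠ j → δ ≤ dist (x i) (x j)) → ∀ j : Fin N,
          ¬ IsTwoShellGood (1 / 20) (47 / 50) 1 x j →
          (∃ i : Fin N, IsTwoShellGood (1 / 20) (47 / 50) 1 x i ∧ dist (x i) (x j) ≤ 3) →
            (⨅ Q : PeriodicConfiguration 3, Q.energyPerParticle lennardJones) + g ≤
              (1 / 2 : ℝ) * ∑ k ∈ Finset.univ.erase j, lennardJones (dist (x j) (x k))) := by
  intro h
  set e : ℝ := ⨅ Q : PeriodicConfiguration 3, Q.energyPerParticle lennardJones with he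
  obtain ⟨M, hMdef⟩ : ∃ M : ℕ, M = max 19 (⌈-100 * e⌉₊ + 1) := ⟨_, rfl⟩
  have hM19 : 19 ≤ M := by rw [hMdef]; exact le_max_left _ _
  have hM0 : 0 < M := by omega
  have hMe : -(M : ℝ) / 100 < e := by
    have h1 : (⌈-100 * e⌉₊ : ℝ) + 1 ≤ M := by
      have : ⌈-100 * e⌉₊ + 1 ≤ M := by rw [hMdef]; exact le_max_right _ _
      exact_mod_cast this
    have h2 := Nat.le_ceil (-100 * e)
    rw [div_lt_iff₀ (by norm_num : (0:ℝ) < 100)]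
    linarith
  have hMr : (0 : ℝ) < M := by exact_mod_cast hM0
  obtain ⟨g, hg, H⟩ := h (2 / (5 * (M : ℝ))) (by positivity)
  have := H (18 + (M + 2)) (cfg M) (cfg_separated hM0) (iQ M) (not_good_iQ hM19)
    ⟨iO M, good_iO M, by rw [dist_iO_iQ]⟩
  linarith [halfSite_iQ_le hM0]

end Summit.AtomisticToContinuum.Crystallization.Theorems.NearFarGlueRNegative
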